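import Literature.AlgebraicGeometry.HodgeTheory.WeilClassesFieldThetaTrace
import Literature.AlgebraicGeometry.Deligne1982.WeilTypeCMHodgeGroupLeSU
import HarnessLib

/-!
# Moonen–Zarhin's criteria ASSEMBLED for type 4: «`W_F` consists of Hodge classes» (Criterion (1): `n_σ = n_σ̄`) AND «all
# non-zero classes in `W_F` are exceptional» (Criterion (2): `θ ≠ 0`) — the existence of EXCEPTIONAL WEIL–HODGE CLASSES in
# `W_F`, from `End(X)`-level data (Moonen–Zarhin 1998 §1, on the carrier `H¹(X(ℂ); ℂ)`)

Layer `Literature/AlgebraicGeometry/HodgeTheory`; THEOREMS ONLY — no definition, no named fact, no `sorry` (D-0026, net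
debt 0).  Assembly of the tree's Criterion (1) in `End(X)`-level form
(`Deligne1982.weilClassesField_le_hodgeClassSpan_iff_forall_eigenMultiplicity_eq`: `W_F ⊗ ℂ ≤ Bᵐ ⊗ ℂ` iff `n_ρ = n_ρ̄` at
every complex root `ρ` of `P`) with the seat's Criterion (2) for type 4 from `End(X)`-level data
(`WeilClassesFieldTypeFourDichotomy`: eigenvalue balance; `WeilClassesFieldThetaTrace`: the trace map `θ` as printed).
The print states Criterion (2) UNDER the hypothesis that `W_F` consists of Hodge classes; this file records the joint
statement — when does `W_F` contain (equivalently: consist, apart from `0`, of) EXCEPTIONAL HODGE classes.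

## The print

B. J. J. Moonen, Yu. G. Zarhin, *Weil classes on abelian varieties*, J. reine angew. Math. **496** (1998) 83–92 =
arXiv:alg-geom/9612017 [MoonenZarhin1998WeilClasses], §1 (held text `paper:arxiv-alg-geom_9612017`).  Chunk p0001 L10–L18
(Introduction): the Weil classes `W_F` «are Hodge classes if and only if …» [their Criterion (1), = Deligne's Prop. 4.4 for
imaginary quadratic `F`] and the question «whether they are exceptional»; chunk p0003 L59–L80, Criterion (2), VERBATIM:
«Suppose `F ↪ End⁰(X)` is a subfield such that `W_F = ⋀^r_F V_X` consists of Hodge classes (see section (crit1), and recall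
that this assumption implies that `r = dim_F(V_X)` is even). Then either all classes in `W_F` are decomposable, or all
non-zero classes in `W_F` are exceptional; this last possibility occurs precisely in the following cases: … `Y` is of Type
4, `d = 1`, `m = 1` and `F ⊄ E₀`, `Y` is of Type 4 with `d ≥ 2` or `m ≥ 2` and the map `θ : E₋ ↪ End_F(V_X) —Tr_F→ F` is
non-zero.»  P. Deligne, *Hodge cycles on abelian varieties*, LNM 900 (1982) [Deligne1982HodgeCycles], Prop. 4.4
(`n_σ = n_σ̄`).

## What is proved (type 4 read at `End(X)`-level: CM centre `E = ℚ(ψ)`, as in `WeilClassesFieldTypeFourDichotomy`)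

For a complex abelian variety `A`, `h ∈ B¹(A) ⊗ ℂ` with `Q_h` non-degenerate, `φ ∈ End(A)` with `P(φ) = 0` (`P` monic
irreducible of degree `e`, `e · 2m = 2 dim A`, `m ≠ 0`), `ψ ∈ End(A)` central with `R(ψ) = 0` (`R` monic irreducible over
`ℚ`), Rosati image `ψ'` with `N'ψ' ∈ ℤ[ψ]`, `ψ' ≠ ψ`, and `Z(End⁰(A)) = ℚ(ψ)`:
* **`weilClassesField_le_hodgeClassSpan_and_inf_divisorClassesSpan_eq_bot_iff_of_CMCentre_End`** — `W_F ⊗ ℂ ≤ Bᵐ ⊗ ℂ` AND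
  `W_F ⊗ ℂ ⊓ 𝒟ᵐ ⊗ ℂ = 0` (the Weil classes are Hodge classes, all non-zero ones exceptional) IFF `n_ρ = n_ρ̄` at every
  root `ρ` of `P` AND the multiplicities of some `σ` for `ψ^*`, `ψ'^*` on some `V_ρ` differ («`θ ≠ 0`», balance form);
* **`weilClassesField_le_hodgeClassSpan_and_inf_divisorClassesSpan_eq_bot_iff_trace_of_CMCentre_End`** — the same with
  «`θ ≠ 0`» AS PRINTED: some Rosati-skew `α` with `N α ∈ ℤ[ψ]` (`α ∈ E₋`) has `Tr(α^* | V_ρ) ≠ 0` at some root `ρ`;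
* `weilClassesField_not_le_hodgeClassSpan_or_le_divisorClassesSpan_or_of_CMCentre_End` — the resulting TRICHOTOMY: `W_F` is
  not made of Hodge classes, or consists of decomposable (hence algebraic) classes, or consists of Hodge classes all of
  whose non-zero members are exceptional.

## References

* [MoonenZarhin1998WeilClasses] B. J. J. Moonen, Yu. G. Zarhin, Weil classes on abelian varieties, J. reine angew. Math.
  496 (1998) 83–92; arXiv:alg-geom/9612017: Introduction (chunk p0001 L10–L18), §1 Criterion (1) (crit1) and Criterion (2)
  (chunk p0003 L59–L106).
* [Deligne1982HodgeCycles] P. Deligne, Hodge cycles on abelian varieties, LNM 900 (1982), Prop. 4.4, I §3 Prop. 3.4.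
* [Milne1999LefschetzClasses] J. S. Milne, Lefschetz classes on abelian varieties, Duke Math. J. 96 (1999), Thm. 3.2,
  Cor. 4.5.

## Provenance

Lane `lit-hodgefound` (Track 2, Layer A), prover seat `lit-hodgefound-p21` (generation 26), row g26-#7.
-/

noncomputable section

open CategoryTheory Polynomial Module
open Literature.AlgebraicTopology.SingularHomology
open Literature.AlgebraicGeometry.Motives
open Literature.AlgebraicGeometry.VanGeemen1994 (hodgeClassSpan pullbackOne)
open Literature.AlgebraicGeometry.Milne1999
open Literature.Barriers.HodgeConjecture (divisorClassesSpan)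

namespace Literature.AlgebraicGeometry.HodgeTheory

section TypeFour

variable {A : AbelianVariety ℂ} {h : complexBetti A.X 2} {φ ψ ψ' : A ⟶ A} {P R : Polynomial ℤ} {e m : ℕ}

/-- **EXCEPTIONAL WEIL–HODGE CLASSES, TYPE 4, FROM `End(X)` (balance form).**  Under the `End(X)`-level type-4 hypotheses,
`W_F ⊗ ℂ` consists of Hodge classes all of whose non-zero members are exceptional — `W_F ⊗ ℂ ≤ Bᵐ ⊗ ℂ` and
`W_F ⊗ ℂ ⊓ 𝒟ᵐ ⊗ ℂ = ⊥` — iff `n_ρ = n_ρ̄` at every complex root `ρ` of `P` (Criterion (1)) and, for some root `ρ` and some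
`σ`, `dim(V_ρ ∩ ker(ψ^* − σ)) ≠ dim(V_ρ ∩ ker(ψ'^* − σ))` (Criterion (2), «`θ ≠ 0`»).
[cite: MoonenZarhin1998WeilClasses, §1 Criterion (1) and Criterion (2), cases «Type 4» (chunk p0003 L59–L80)]
[cite: Deligne1982HodgeCycles, Prop. 4.4] -/
theorem weilClassesField_le_hodgeClassSpan_and_inf_divisorClassesSpan_eq_bot_iff_of_CMCentre_End (hPm : P.Monic)
    (hPe : P.natDegree = e) (hPirr : Irreducible (P.map (Int.castRingHom ℚ)))
    (hφ : Polynomial.eval₂ (Int.castRingHom (CategoryTheory.End A)) (φ : CategoryTheory.End A) P = 0)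
    (her : e * (2 * m) = 2 * A.dim) (hm : m ≠ 0) (hh : h ∈ hodgeClassSpan A.dim A.X 1)
    (hnd : ∀ x : complexBetti A.X 1, (∀ y, polarizationPairingOne A.X h (A.dim - 1) x y = 0) → x = 0)
    (hψ : ∀ χ : A ⟶ A, ψ ≫ χ = χ ≫ ψ) (hRm : R.Monic) (hRirr : Irreducible (R.map (Int.castRingHom ℚ)))
    (hψR : Polynomial.eval₂ (Int.castRingHom (CategoryTheory.End A)) (ψ : CategoryTheory.End A) R = 0)
    (hadj : ∀ x y : complexBetti A.X 1, polarizationPairingOne A.X h (A.dim - 1) (pullbackOne A ψ x) y =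
      polarizationPairingOne A.X h (A.dim - 1) x (pullbackOne A ψ' y))
    (hψ'E : ∃ N : ℤ, N ≠ 0 ∧ End.of (N • ψ') ∈ Subring.closure {End.of ψ}) (hne : ψ' ≠ ψ)
    (hZ : ∀ g : A ⟶ A, (∀ χ : A ⟶ A, g ≫ χ = χ ≫ g) →
      ∃ N : ℤ, N ≠ 0 ∧ End.of (N • g) ∈ Subring.closure {End.of ψ}) :
    (weilClassesField A φ P (2 * m) ≤ hodgeClassSpan A.dim A.X m ∧
        weilClassesField A φ P (2 * m) ⊓ divisorClassesSpan A.X A.dim m = ⊥) ↔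
      (∀ ρ : ℂ, Polynomial.eval₂ (Int.castRingHom ℂ) ρ P = 0 →
          eigenMultiplicity A φ ρ = eigenMultiplicity A φ (starRingEnd ℂ ρ)) ∧
        ∃ ρ σ : ℂ, Polynomial.eval₂ (Int.castRingHom ℂ) ρ P = 0 ∧
          Module.finrank ℂ ↥((pullbackOne A φ).eigenspace ρ ⊓ (pullbackOne A ψ).eigenspace σ) ≠
            Module.finrank ℂ ↥((pullbackOne A φ).eigenspace ρ ⊓ (pullbackOne A ψ').eigenspace σ) := by
  rw [Deligne1982.weilClassesField_le_hodgeClassSpan_iff_forall_eigenMultiplicity_eq hPm hPe hPirr hφ her,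
    weilClassesField_inf_divisorClassesSpan_eq_bot_iff_exists_finrank_ne_of_CMCentre_End hPm hPe hPirr hφ her hm hh hnd hψ hRm
      hRirr hψR hadj hψ'E hne hZ]

/-- **EXCEPTIONAL WEIL–HODGE CLASSES, TYPE 4, FROM `End(X)`, WITH `θ` AS PRINTED.**  Under the same hypotheses, `W_F ⊗ ℂ`
consists of Hodge classes all of whose non-zero members are exceptional iff `n_ρ = n_ρ̄` at every root of `P` AND «the
map `θ : E₋ ↪ End_F(V_X) —Tr_F→ F` is non-zero»: some `α ∈ End(A)` with `N α ∈ ℤ[ψ]`, `N ≠ 0`, Rosati-skew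
(`Q_h(α^* u, v) = −Q_h(u, α^* v)`, i.e. `α ∈ E₋`) has `Tr(α^* | V_ρ) ≠ 0` at some root `ρ`.
[cite: MoonenZarhin1998WeilClasses, §1 Criterion (1) and Criterion (2), cases «Type 4 … the map θ … is non-zero» (chunk p0003 L59–L80, L92–L106)]
[cite: Deligne1982HodgeCycles, Prop. 4.4] -/
theorem weilClassesField_le_hodgeClassSpan_and_inf_divisorClassesSpan_eq_bot_iff_trace_of_CMCentre_End (hPm : P.Monic)
    (hPe : P.natDegree = e) (hPirr : Irreducible (P.map (Int.castRingHom ℚ)))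
    (hφ : Polynomial.eval₂ (Int.castRingHom (CategoryTheory.End A)) (φ : CategoryTheory.End A) P = 0)
    (her : e * (2 * m) = 2 * A.dim) (hm : m ≠ 0) (hh : h ∈ hodgeClassSpan A.dim A.X 1)
    (hnd : ∀ x : complexBetti A.X 1, (∀ y, polarizationPairingOne A.X h (A.dim - 1) x y = 0) → x = 0)
    (hψ : ∀ χ : A ⟶ A, ψ ≫ χ = χ ≫ ψ) (hRm : R.Monic) (hRirr : Irreducible (R.map (Int.castRingHom ℚ)))
    (hψR : Polynomial.eval₂ (Int.castRingHom (CategoryTheory.End A)) (ψ : CategoryTheory.End A) R = 0)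
    (hadj : ∀ x y : complexBetti A.X 1, polarizationPairingOne A.X h (A.dim - 1) (pullbackOne A ψ x) y =
      polarizationPairingOne A.X h (A.dim - 1) x (pullbackOne A ψ' y))
    (hψ'E : ∃ N : ℤ, N ≠ 0 ∧ End.of (N • ψ') ∈ Subring.closure {End.of ψ}) (hne : ψ' ≠ ψ)
    (hZ : ∀ g : A ⟶ A, (∀ χ : A ⟶ A, g ≫ χ = χ ≫ g) →
      ∃ N : ℤ, N ≠ 0 ∧ End.of (N • g) ∈ Subring.closure {End.of ψ}) :
    (weilClassesField A φ P (2 * m) ≤ hodgeClassSpan A.dim A.X m ∧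
        weilClassesField A φ P (2 * m) ⊓ divisorClassesSpan A.X A.dim m = ⊥) ↔
      (∀ ρ : ℂ, Polynomial.eval₂ (Int.castRingHom ℂ) ρ P = 0 →
          eigenMultiplicity A φ ρ = eigenMultiplicity A φ (starRingEnd ℂ ρ)) ∧
        ∃ (α : A ⟶ A) (hα : ∃ N : ℤ, N ≠ 0 ∧ End.of (N • α) ∈ Subring.closure {End.of ψ}),
          (∀ u v, polarizationPairingOne A.X h (A.dim - 1) (pullbackOne A α u) v =
            -polarizationPairingOne A.X h (A.dim - 1) u (pullbackOne A α v)) ∧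
          ∃ ρ : ℂ, Polynomial.eval₂ (Int.castRingHom ℂ) ρ P = 0 ∧
            LinearMap.trace ℂ _ ((pullbackOne A α).restrict
              (CentralTorus.mapsTo_eigenspace_pullbackOne_of_exists_zsmul_mem_closure hψ hα φ ρ)) ≠ 0 := by
  rw [Deligne1982.weilClassesField_le_hodgeClassSpan_iff_forall_eigenMultiplicity_eq hPm hPe hPirr hφ her,
    weilClassesField_inf_divisorClassesSpan_eq_bot_iff_exists_trace_restrict_ne_zero_of_CMCentre_End hPm hPe hPirr hφ her hm hh
      hnd hψ hRm hRirr hψR hadj hψ'E hne hZ]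

/-- **THE TRICHOTOMY FOR `W_F`, TYPE 4, FROM `End(X)`**: either `W_F ⊗ ℂ` is not contained in the Hodge classes, or it
consists of decomposable classes (`≤ 𝒟ᵐ ⊗ ℂ`, hence of algebraic Hodge classes), or it consists of Hodge classes all of
whose non-zero members are exceptional («Then either all classes in `W_F` are decomposable, or all non-zero classes in
`W_F` are exceptional»). [cite: MoonenZarhin1998WeilClasses, §1 Criterion (2) (chunk p0003 L59–L67)] -/
theorem weilClassesField_not_le_hodgeClassSpan_or_le_divisorClassesSpan_or_of_CMCentre_End (hPm : P.Monic)
    (hPe : P.natDegree = e) (hPirr : Irreducible (P.map (Int.castRingHom ℚ)))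
    (hφ : Polynomial.eval₂ (Int.castRingHom (CategoryTheory.End A)) (φ : CategoryTheory.End A) P = 0)
    (her : e * (2 * m) = 2 * A.dim) (hm : m ≠ 0) (hh : h ∈ hodgeClassSpan A.dim A.X 1)
    (hnd : ∀ x : complexBetti A.X 1, (∀ y, polarizationPairingOne A.X h (A.dim - 1) x y = 0) → x = 0)
    (hψ : ∀ χ : A ⟶ A, ψ ≫ χ = χ ≫ ψ) (hRm : R.Monic) (hRirr : Irreducible (R.map (Int.castRingHom ℚ)))
    (hψR : Polynomial.eval₂ (Int.castRingHom (CategoryTheory.End A)) (ψ : CategoryTheory.End A) R = 0)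
    (hadj : ∀ x y : complexBetti A.X 1, polarizationPairingOne A.X h (A.dim - 1) (pullbackOne A ψ x) y =
      polarizationPairingOne A.X h (A.dim - 1) x (pullbackOne A ψ' y))
    (hψ'E : ∃ N : ℤ, N ≠ 0 ∧ End.of (N • ψ') ∈ Subring.closure {End.of ψ}) (hne : ψ' ≠ ψ)
    (hZ : ∀ g : A ⟶ A, (∀ χ : A ⟶ A, g ≫ χ = χ ≫ g) →
      ∃ N : ℤ, N ≠ 0 ∧ End.of (N • g) ∈ Subring.closure {End.of ψ}) :
    ¬ weilClassesField A φ P (2 * m) ≤ hodgeClassSpan A.dim A.X m ∨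
      weilClassesField A φ P (2 * m) ≤ divisorClassesSpan A.X A.dim m ∨
      (weilClassesField A φ P (2 * m) ≤ hodgeClassSpan A.dim A.X m ∧
        weilClassesField A φ P (2 * m) ⊓ divisorClassesSpan A.X A.dim m = ⊥) := by
  by_cases hH : weilClassesField A φ P (2 * m) ≤ hodgeClassSpan A.dim A.X m
  · rcases weilClassesField_le_or_inf_divisorClassesSpan_eq_bot_of_CMCentre_End hPm hPe hPirr hφ her hm hh hnd hψ hRm hRirr
        hψR hadj hψ'E hne hZ with hD | hE
    · exact Or.inr (Or.inl hD)
    · exact Or.inr (Or.inr ⟨hH, hE⟩)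
  · exact Or.inl hH

end TypeFour

end Literature.AlgebraicGeometry.HodgeTheory

end
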